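import Mathlib

/-!
# Shape diversity of near-apex ladders — one injection into `Fin K × ZMod m` (Mathlib API proof)

Support file for item `stmt-MatrixMultiplication-14308` (`FourierTwoFamiliesModP.PrimeTwoFamilies`,
CKSU 2005 Conj. 4.7 with prime cyclic hosts), line `Sketch`, registered stub
`ladder_rpow_le_rightShapes` (siege k9, variation "Mathlib API route"; an independent proof of the
same statement, via shape packing and fiberwise sums, sits in namespace
`…Theorems.PrimeTwoFamilies.LadderLift`).

A LADDER in `ZMod m` is a family of `r` classes `(X c, Y c)`, `c : Fin r`, with

* (`hW`) every class direct: `(x - x') + (y - y') = 0` with `x, x' ∈ X c`, `y, y' ∈ Y c` forces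
  `x = x'` and `y = y'`;
* (`hL`) for classes `p < q` every cross difference `y' - x'` (`x' ∈ X p`, `y' ∈ Y q`) avoids every
  diagonal difference `y - x` (`x ∈ X c`, `y ∈ Y c`, any class `c`).

THE ARGUMENT.  Suppose the `Y`-sides are translates `Y c = u c +ᵥ Y₀ (κ c)` of `K` templates.  The
single map
`(c, x, b) ↦ (κ c, b - x)`, `x ∈ X c`, `b ∈ Y₀ (κ c)`,
from the sigma-finset `univ.sigma fun c => X c ×ˢ Y₀ (κ c)` to `Fin K × ZMod m` is INJECTIVE
(`sub_template_injOn`): equal images put both points in one right class `k`, with `b - x = b' - x'`;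
re-translating both template points by `u c` of the LARGER class index turns this into a diagonal
difference of that class equal to a cross difference from (smaller class) × (larger class), excluded
by `hL`; and inside one class it is a collision of differences, excluded by directness `hW`.  Hence
(`Finset.card_le_card_of_injOn`, `Finset.card_sigma`, `Finset.card_vadd_finset`)
`Σ_c |X c|·|Y c| ≤ K·m` (`sum_card_mul_card_le`), and with `m^{1/2-ε} ≤ r`, `m^{1-ε} ≤ |X c||Y c|`:
`m^{1/2-2ε} = m^{1/2-ε}·m^{1-ε}/m ≤ r·m^{1-ε}/m ≤ K` (`Real.rpow_add`, `Real.rpow_sub_one`).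
-/

-- single-conjunct summit: the mandated namespace repeats `MatrixMultiplication` (summit = sub-problem).
set_option linter.dupNamespace false

namespace Summit.MatrixMultiplication.MatrixMultiplication.Theorems.PrimeTwoFamilies.LadderLift.SiegeK9

open Finset
open scoped Pointwise

/-- **Cross-class separation inside one right class.**  In a ladder, if for classes `p < q` the
`Y`-side of the larger class contains two translated template points `v + b, v + b' ∈ Y q`, then
`b - x ≠ b' - x'` for `x ∈ X p`, `x' ∈ X q`: otherwise translating by `v` gives the diagonal
difference `(v + b') - x'` of class `q` equal to the cross difference `(v + b) - x` from `X p × Y q`,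
excluded by `hL` at `(q, p, q)`. -/
theorem sub_ne_sub_of_lt {G : Type*} [AddCommGroup G] {r : ℕ} (X Y : Fin r → Finset G)
    (hL : ∀ c p q : Fin r, p < q → ∀ x ∈ X c, ∀ y ∈ Y c, ∀ x' ∈ X p, ∀ y' ∈ Y q, y - x ≠ y' - x')
    {p q : Fin r} (hpq : p < q) (v : G) {x x' b b' : G} (hx : x ∈ X p) (hx' : x' ∈ X q)
    (hb : v + b ∈ Y q) (hb' : v + b' ∈ Y q) : b - x ≠ b' - x' := by
  intro h
  refine hL q p q hpq x' hx' (v + b') hb' x hx (v + b) hb ?_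
  rw [add_sub_assoc, add_sub_assoc, h]

/-- **The single injection.**  For a ladder whose `Y`-sides are the translates
`Y c = u c +ᵥ Y₀ (κ c)`, the map `(c, x, b) ↦ (κ c, b - x)` is injective on
`univ.sigma fun c => X c ×ˢ Y₀ (κ c)`. -/
theorem sub_template_injOn {G : Type*} [AddCommGroup G] [DecidableEq G] {r K : ℕ}
    (X Y : Fin r → Finset G)
    (hW : ∀ c : Fin r, ∀ x ∈ X c, ∀ x' ∈ X c, ∀ y ∈ Y c, ∀ y' ∈ Y c,
      (x - x') + (y - y') = 0 → x = x' ∧ y = y')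
    (hL : ∀ c p q : Fin r, p < q → ∀ x ∈ X c, ∀ y ∈ Y c, ∀ x' ∈ X p, ∀ y' ∈ Y q, y - x ≠ y' - x')
    (Y₀ : Fin K → Finset G) (κ : Fin r → Fin K) (u : Fin r → G)
    (hY : ∀ c, Y c = u c +ᵥ Y₀ (κ c)) :
    Set.InjOn (fun z : (Σ _ : Fin r, G × G) => (κ z.1, z.2.2 - z.2.1))
      ↑((univ : Finset (Fin r)).sigma fun c => X c ×ˢ Y₀ (κ c)) := by
  -- membership of translated template points
  have memY : ∀ c : Fin r, ∀ b ∈ Y₀ (κ c), u c + b ∈ Y c := fun c b hb => by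
    rw [hY c]
    exact vadd_mem_vadd_finset hb
  rintro ⟨c, x, b⟩ hz ⟨c', x', b'⟩ hz' he
  simp only [mem_coe, mem_sigma, mem_univ, true_and, mem_product] at hz hz'
  obtain ⟨hx, hb⟩ := hz
  obtain ⟨hx', hb'⟩ := hz'
  simp only [Prod.mk.injEq] at he
  obtain ⟨hκ, he⟩ := he
  rcases lt_trichotomy c c' with hlt | rfl | hgt
  · -- `c < c'`: re-translate by `u c'`
    have hbY : u c' + b ∈ Y c' := memY c' b (hκ ▸ hb)
    exact absurd he (sub_ne_sub_of_lt X Y hL hlt (u c') hx hx' hbY (memY c' b' hb'))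
  · -- same class: a collision of differences contradicts directness
    have h0 : (x' - x) + ((u c + b) - (u c + b')) = 0 := by
      rw [show (x' - x) + ((u c + b) - (u c + b')) = (b - x) - (b' - x') by abel, he, sub_self]
    obtain ⟨hxx, hbb⟩ := hW c x' hx' x hx (u c + b) (memY c b hb) (u c + b') (memY c b' hb') h0
    obtain rfl := hxx
    obtain rfl : b = b' := add_left_cancel hbb
    rfl
  · -- `c' < c`: re-translate by `u c`
    have hbY : u c + b' ∈ Y c := memY c b' (hκ.symm ▸ hb')
    exact absurd he.symm (sub_ne_sub_of_lt X Y hL hgt (u c) hx' hx hbY (memY c b hb))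

/-- **`K` right templates pack `K` times.**  For a ladder in `ZMod m` whose `Y`-sides are
translates of at most `K` templates, `Σ_c |X c|·|Y c| ≤ K·m` (the single injection into
`Fin K × ZMod m`, `Finset.card_le_card_of_injOn`). -/
theorem sum_card_mul_card_le {m : ℕ} [NeZero m] {r K : ℕ} (X Y : Fin r → Finset (ZMod m))
    (hW : ∀ c : Fin r, ∀ x ∈ X c, ∀ x' ∈ X c, ∀ y ∈ Y c, ∀ y' ∈ Y c,
      (x - x') + (y - y') = 0 → x = x' ∧ y = y')
    (hL : ∀ c p q : Fin r, p < q → ∀ x ∈ X c, ∀ y ∈ Y c, ∀ x' ∈ X p, ∀ y' ∈ Y q, y - x ≠ y' - x')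
    (Y₀ : Fin K → Finset (ZMod m)) (κ : Fin r → Fin K) (u : Fin r → ZMod m)
    (hY : ∀ c, Y c = u c +ᵥ Y₀ (κ c)) :
    ∑ c, (X c).card * (Y c).card ≤ K * m := by
  have hcard : ∀ c, (Y c).card = (Y₀ (κ c)).card := fun c => by rw [hY c, card_vadd_finset]
  have h := card_le_card_of_injOn (t := (univ : Finset (Fin K × ZMod m)))
    (fun z : (Σ _ : Fin r, ZMod m × ZMod m) => (κ z.1, z.2.2 - z.2.1)) (fun _ _ => mem_univ _)
    (sub_template_injOn X Y hW hL Y₀ κ u hY)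
  rw [card_sigma, card_univ, Fintype.card_prod, Fintype.card_fin, ZMod.card] at h
  calc ∑ c, (X c).card * (Y c).card = ∑ c, (X c ×ˢ Y₀ (κ c)).card :=
        sum_congr rfl fun c _ => by rw [card_product, hcard c]
    _ ≤ K * m := h

/-- **Shape diversity, right side** (registered stub of crux stmt-MatrixMultiplication-14308, line
`Sketch`).  A ladder level of the cyclic ladder conjecture's slice `ε` in `ZMod m` — `m^{1/2-ε} ≤ r`
classes, co-volumes `m^{1-ε} ≤ |X c||Y c|` — whose `Y`-sides are translates of at most `K` templates
has `m^{1/2-2ε} ≤ K`: `m^{1/2-2ε} = m^{1/2-ε}·m^{1-ε}/m ≤ r·m^{1-ε}/m ≤ (Σ_c |X c||Y c|)/m ≤ K`. -/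
theorem ladder_rpow_le_rightShapes {m : ℕ} [NeZero m] {r K : ℕ} (X Y : Fin r → Finset (ZMod m))
    (hW : ∀ c : Fin r, ∀ x ∈ X c, ∀ x' ∈ X c, ∀ y ∈ Y c, ∀ y' ∈ Y c,
      (x - x') + (y - y') = 0 → x = x' ∧ y = y')
    (hL : ∀ c p q : Fin r, p < q → ∀ x ∈ X c, ∀ y ∈ Y c, ∀ x' ∈ X p, ∀ y' ∈ Y q, y - x ≠ y' - x')
    (Y₀ : Fin K → Finset (ZMod m)) (κ : Fin r → Fin K) (u : Fin r → ZMod m)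
    (hY : ∀ c, Y c = u c +ᵥ Y₀ (κ c))
    {ε : ℝ} (hr : (m : ℝ) ^ (1 / 2 - ε) ≤ (r : ℝ))
    (hP : ∀ c : Fin r, (m : ℝ) ^ (1 - ε) ≤ (((X c).card * (Y c).card : ℕ) : ℝ)) :
    (m : ℝ) ^ (1 / 2 - 2 * ε) ≤ (K : ℝ) := by
  have hmpos : (0 : ℝ) < m := Nat.cast_pos.2 (NeZero.pos m)
  -- the packing, cast to `ℝ`
  have hsum : (r : ℝ) * (m : ℝ) ^ (1 - ε) ≤ (K : ℝ) * m := by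
    calc (r : ℝ) * (m : ℝ) ^ (1 - ε) = ∑ _c : Fin r, (m : ℝ) ^ (1 - ε) := by
          rw [sum_const, card_univ, Fintype.card_fin, nsmul_eq_mul]
      _ ≤ ∑ c : Fin r, (((X c).card * (Y c).card : ℕ) : ℝ) := sum_le_sum fun c _ => hP c
      _ ≤ (K : ℝ) * m := by
          exact_mod_cast (Nat.cast_sum _ _).symm.le.trans
            (Nat.cast_le.2 (sum_card_mul_card_le X Y hW hL Y₀ κ u hY))
  -- exponent bookkeeping
  calc (m : ℝ) ^ (1 / 2 - 2 * ε) = (m : ℝ) ^ (1 / 2 - ε) * (m : ℝ) ^ (1 - ε) / m := by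
        rw [← Real.rpow_add hmpos, ← Real.rpow_sub_one hmpos.ne']
        ring_nf
    _ ≤ (r : ℝ) * (m : ℝ) ^ (1 - ε) / m := by gcongr
    _ ≤ (K : ℝ) * m / m := by gcongr
    _ = K := mul_div_cancel_right₀ _ hmpos.ne'

end Summit.MatrixMultiplication.MatrixMultiplication.Theorems.PrimeTwoFamilies.LadderLift.SiegeK9
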